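import Summits.MatrixMultiplication.OmegaCensus.STPPVosperTightStructure
import Summits.MatrixMultiplication.OmegaCensus.STPPVosperClash225Tools

/-!
# ω-census (abelian STPP census): a VOSPER CLASH — the beating pattern {(2,2,5),(2,5,2),(5,2,2)} has no STPP family in ℤ₅₉ (kernel)

HONEST FRAMING (pub-omega census; verbatim): lottery ticket; floor = certified bounds/negative ranges.
Census STRUCTURE (seat pub-omega-stpp-1 gen 28, 2026-08-28), family (b2).  This EXCLUDES one candidate pattern (`Σ aᵢbᵢcᵢ = 60 > 59`) of the ℤ₅₉ front of
record — a leaf no counting law of record (N7–N20) decides; nothing here is progress on `ω`.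

## Statement and proof

`no_isSTPP_zmod59_225_252_522`: there is no STPP family (CKSU 2005 Def. 5.1, the tree's `IsSTPP`) `(Aᵢ,Bᵢ,Cᵢ)_{i<3}` in `ℤ/59ℤ` with
`(|Aᵢ|,|Bᵢ|,|Cᵢ|) = (2,2,5), (2,5,2), (5,2,2)`.  Write `Y_k = C_k − B_k`, `Z_k = C_k − A_k` (`STPPKneser.D`).

* Step 0 (`vosper225_structure`): the N18 chain (`STPPAlignedDoubleKneserFilter`) is TIGHT at block `(2,5,2)` (`20+5+20+2+14 = 61 = 59+2`) and at block
  `(5,2,2)` (`14+2+20+5+20 = 61`), so `vosper_structure_of_n18_tight` (`STPPVosperTightStructure`) gives nonzero `e, e′, d, d′` with `A₃` a 5-progression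
  and `Y₁⊔Y₂` a 20-progression of step `e`, `B₃` a 2- and `Z₁⊔Z₂` a 14-progression of step `e′`, `B₂` a 5- and `Z₁⊔Z₃` a 20-progression of step `d′`.
* Step 1 (`vosper225_step1`): `γ − B₂ ⊆ Y₂ ⊆ Y₁⊔Y₂` and `γ′ − A₃ ⊆ Z₃ ⊆ Z₁⊔Z₃` are 5-progressions inside 20-progressions of the other step, so
  `d′ = ±e` (`STPPVosperPositionLemmas.eq_or_eq_neg_of_mutual_apFinset_subset`, `19² < 16·58`).
* Step 2 (`exists_run4`): `Z₃ = (γ − A₃) ⊔ (γ̄ − A₃)` is two 5-progressions of step `d′` filling 10 of the 20 places of `Z₁⊔Z₃`; transporting to `{0,…,19}` by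
  `x ↦ d′⁻¹(x − z₀)` the complement contains a 4-run (decidable facts `run5_start`, `run4_outside` about `ℤ₅₉`), i.e. `Z₁ ⊇` a 4-progression of step `d′`.
* Step 3 (`step_pm_of_run4`): that 4-progression sits in the 14-progression `Z₁⊔Z₂` of step `e′`, so `d′ = k·e′`, `|k| ≤ 4`
  (`exists_int_mul_of_apFinset_subset`); two consecutive terms of `Z₁⊔Z₂` lie in `Z₁ ⊆` the 20-progression of step `d′` (`exists_adjacent`: `|Z₂| = 4` touches at
  most 8 of the 13 consecutive pairs), so `e′ = j·d′`, `|j| ≤ 19`; `kj ≡ 1 (mod 59)` leaves `j ∈ {±1, ±15}`, and `j = ±15` is impossible because a 14-progression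
  of step `±15` meets a 20-run in at most `8 < 10 = |Z₁|` points (decidable `ap14_step15_meets_run20`, `ap14_step_neg15_meets_run20`).  Hence `e′ = ±d′`.
* Step 5: `B₃ = {b, b + e′}` and `A₃ ∋ α′, α′ + d′` with `e′ = ±d′`: the Def-5.1 word `(s′ − s) + (t′ − t) + (γ − γ) = 0` at index pattern `(2,2,2)` with
  `{s, s′} = {α′, α′ + d′}`, `t = b`, `t′ = b + e′` holds, so the TPP of block 3 forces `t = t′`, i.e. `e′ = 0` — contradiction.

Only Def. 5.1 (through the tree's N18 chain, the directness of the `D`-sets, and two literal words), Vosper's theorem (tree, Nathanson Thm 2.7) and integer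
bookkeeping in windows of length `≤ 20 < 59/2` are used.  Paper version (with the `Y`-side variant of Steps 3–4): HOME `pub-omega-stpp-1-g28/VOSPER-CLASH-225.md`;
engine cross-check (stpp-2's `sgen.c`): UNSAT, 734 320 817 nodes.  Not claimed, but the same steps are expected to work for `{(2,2,c),(2,c,2),(c,2,2)}` at the
primes `p = 11c + 4` where this pattern is N18-tight (`c = 9`: 103, `c = 17`: 191, …).

References: A. G. Vosper, J. London Math. Soc. 31 (1956); M. B. Nathanson, *Additive Number Theory: Inverse Problems*, GTM 165, Thm 2.7; H. Cohn,
R. Kleinberg, B. Szegedy, C. Umans, FOCS 2005 (arXiv:math/0511460), Def. 5.1.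
-/

open Finset
open scoped Pointwise

namespace Summit.MatrixMultiplication.OmegaCensus.CubeNB

open Literature.Computability.AlgebraicComplexity
open Literature.Combinatorics.Additive
open Summit.MatrixMultiplication.OmegaCensus.STPPKneser


/-- Step 0 + structure: for an STPP family of pattern `{(2,2,5),(2,5,2),(5,2,2)}` in `ℤ₅₉`, Vosper structure at blocks `1` and `2`.
[cite: CohnKleinbergSzegedyUmans2005, Def. 5.1] [cite: Nathanson1996, Thm 2.7] -/
theorem vosper225_structure (A B C : Fin 3 → Finset (ZMod 59)) (hS : IsSTPP A B C)
    (hA : ∀ i, #(A i) = ![2, 2, 5] i) (hB : ∀ i, #(B i) = ![2, 5, 2] i) (hC : ∀ i, #(C i) = ![5, 2, 2] i) :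
    ((∃ e : ZMod 59, e ≠ 0 ∧ IsAP (A 2) e ∧ IsAP (DU B C (univ.erase 2)) e) ∧
      (∃ e' : ZMod 59, e' ≠ 0 ∧ IsAP (B 2) e' ∧ IsAP (DU A C (univ.erase 2)) e')) ∧
    ((∃ d : ZMod 59, d ≠ 0 ∧ IsAP (A 1) d ∧ IsAP (DU B C (univ.erase 1)) d) ∧
      (∃ d' : ZMod 59, d' ≠ 0 ∧ IsAP (B 1) d' ∧ IsAP (DU A C (univ.erase 1)) d')) := by
  haveI : Fact (Nat.Prime 59) := ⟨prime_59⟩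
  have hAne : ∀ i, (A i).Nonempty := fun i => card_pos.1 (by rw [hA]; fin_cases i <;> simp)
  have hBne : ∀ i, (B i).Nonempty := fun i => card_pos.1 (by rw [hB]; fin_cases i <;> simp)
  have hCne : ∀ i, (C i).Nonempty := fun i => card_pos.1 (by rw [hC]; fin_cases i <;> simp)
  have e2 : (univ : Finset (Fin 3)).erase 2 = {0, 1} := by decide
  have e1 : (univ : Finset (Fin 3)).erase 1 = {0, 2} := by decide
  have hI2 : ((univ : Finset (Fin 3)).erase 2).Nonempty := ⟨0, by decide⟩
  have hI1 : ((univ : Finset (Fin 3)).erase 1).Nonempty := ⟨0, by decide⟩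
  have s2AC : ∑ k ∈ (univ : Finset (Fin 3)).erase 2, #(A k) * #(C k) = 14 := by
    rw [e2, Finset.sum_pair (by decide)]; simp [hA, hC]
  have s2BC : ∑ k ∈ (univ : Finset (Fin 3)).erase 2, #(B k) * #(C k) = 20 := by
    rw [e2, Finset.sum_pair (by decide)]; simp [hB, hC]
  have s1AC : ∑ k ∈ (univ : Finset (Fin 3)).erase 1, #(A k) * #(C k) = 20 := by
    rw [e1, Finset.sum_pair (by decide)]; simp [hA, hC]
  have s1BC : ∑ k ∈ (univ : Finset (Fin 3)).erase 1, #(B k) * #(C k) = 14 := by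
    rw [e1, Finset.sum_pair (by decide)]; simp [hB, hC]
  have hA2 : #(A 2) = 5 := by rw [hA]; simp
  have hB2 : #(B 2) = 2 := by rw [hB]; simp
  have hC2 : #(C 2) = 2 := by rw [hC]; simp
  have hA1 : #(A 1) = 2 := by rw [hA]; simp
  have hB1 : #(B 1) = 5 := by rw [hB]; simp
  have hC1 : #(C 1) = 2 := by rw [hC]; simp
  refine ⟨?_, ?_⟩
  · obtain ⟨h1, d', hd', hBap, hZap, -, -⟩ := vosper_structure_of_n18_tight hS hAne hBne hCne 2 hI2
      (by rw [hA2]; omega) (by rw [hB2]) (by rw [s2BC]; omega) (by rw [s2AC]; omega)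
      (by rw [s2AC, s2BC, hA2, hB2, hC2])
    exact ⟨h1, d', hd', hBap, hZap⟩
  · obtain ⟨h1, d', hd', hBap, hZap, -, -⟩ := vosper_structure_of_n18_tight hS hAne hBne hCne 1 hI1
      (by rw [hA1]) (by rw [hB1]; omega) (by rw [s1BC]; omega) (by rw [s1AC]; omega)
      (by rw [s1AC, s1BC, hA1, hB1, hC1])
    exact ⟨h1, d', hd', hBap, hZap⟩



/-- **Step 1.** In the situation of `vosper225_structure`, the difference `d′` of the 20-progression `Z₁ ⊔ Z₃` (and of `B₂`) equals `±e`, `e` the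
difference of the 20-progression `Y₁ ⊔ Y₂` (and of `A₃`): both contain a 5-term progression of the other difference
(`γ − B₂ ⊆ Y₂`, `γ′ − A₃ ⊆ Z₃`), and `19² < 16·58` (`eq_or_eq_neg_of_mutual_apFinset_subset`). [cite: Nathanson1996, Thm 2.7] -/
theorem vosper225_step1 (A B C : Fin 3 → Finset (ZMod 59)) (hS : IsSTPP A B C)
    (hA : ∀ i, #(A i) = ![2, 2, 5] i) (hB : ∀ i, #(B i) = ![2, 5, 2] i) (hC : ∀ i, #(C i) = ![5, 2, 2] i)
    {e d' : ZMod 59} (he : e ≠ 0) (hd' : d' ≠ 0) (hA3 : IsAP (A 2) e) (hIY : IsAP (DU B C (univ.erase 2)) e)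
    (hB2 : IsAP (B 1) d') (hIZ : IsAP (DU A C (univ.erase 1)) d') : d' = e ∨ d' = -e := by
  haveI : Fact (Nat.Prime 59) := ⟨prime_59⟩
  have hAne : ∀ i, (A i).Nonempty := fun i => card_pos.1 (by rw [hA]; fin_cases i <;> simp)
  have hBne : ∀ i, (B i).Nonempty := fun i => card_pos.1 (by rw [hB]; fin_cases i <;> simp)
  have hCne : ∀ i, (C i).Nonempty := fun i => card_pos.1 (by rw [hC]; fin_cases i <;> simp)
  have e2 : (univ : Finset (Fin 3)).erase 2 = {0, 1} := by decide
  have e1 : (univ : Finset (Fin 3)).erase 1 = {0, 2} := by decide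
  have hIYcard : #(DU B C (univ.erase 2)) = 20 := by
    rw [card_DU_BC hS hAne, e2, Finset.sum_pair (by decide)]; simp [hB, hC]
  have hIZcard : #(DU A C (univ.erase 1)) = 20 := by
    rw [card_DU_AC hS hBne, e1, Finset.sum_pair (by decide)]; simp [hA, hC]
  have hA2 : #(A 2) = 5 := by rw [hA]; simp
  have hB1 : #(B 1) = 5 := by rw [hB]; simp
  obtain ⟨α, hα⟩ := hA3
  obtain ⟨β, hβ⟩ := hB2
  obtain ⟨y₀, hy⟩ := hIY
  obtain ⟨z₀, hz⟩ := hIZ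
  rw [hA2] at hα; rw [hB1] at hβ; rw [hIYcard] at hy; rw [hIZcard] at hz
  obtain ⟨γ, hγ⟩ := hCne 1
  obtain ⟨γ', hγ'⟩ := hCne 2
  -- γ − B₂ ⊆ Y₂ ⊆ Y₁ ⊔ Y₂
  have hsub1 : apFinset (γ - β - 4 • d') d' 5 ⊆ apFinset y₀ e 20 := by
    rw [← image_sub_apFinset, ← hβ, ← hy]
    exact (image_sub_subset_D hγ).trans (D_subset_DU (by decide))
  -- γ′ − A₃ ⊆ Z₃ ⊆ Z₁ ⊔ Z₃
  have hsub2 : apFinset (γ' - α - 4 • e) e 5 ⊆ apFinset z₀ d' 20 := by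
    rw [← image_sub_apFinset, ← hα, ← hz]
    exact (image_sub_subset_D hγ').trans (D_subset_DU (by decide))
  exact eq_or_eq_neg_of_mutual_apFinset_subset hd' he (by norm_num) (by norm_num) hsub1 hsub2 (by norm_num)


/-! ## Step 3: the 14-progression `Z₁ ⊔ Z₂` has step `±d′` -/

section Step3

/-- **Step 3.**  `Z₁ ⊆` a 20-progression of step `d′` and `Z₁ ⊔ Z₂` a 14-progression of step `e′` (`|Z₁| = 10`, `|Z₂| ≤ 4`), with a 4-progression of step `d′`
inside `Z₁` ⇒ `e′ = ±d′`: `d′ = k·e′` (`|k| ≤ 4`), `e′ = j·d′` (`|j| ≤ 19`), `kj ≡ 1 (59)` leaves `j = ±1` or `j = ±15`, and step `±15` meets a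
20-run in at most 8 < 10 points. [cite: Nathanson1996, §2.5] -/
theorem step_pm_of_run4 {d' e' z₀ v r : ZMod 59} {Z1 Z2 : Finset (ZMod 59)} (hd' : d' ≠ 0) (he' : e' ≠ 0)
    (hI : Z1 ⊆ apFinset z₀ d' 20) (hJ : Z1 ∪ Z2 = apFinset v e' 14) (hZ2 : #Z2 ≤ 4) (hZ1 : #Z1 = 10)
    (hr : apFinset r d' 4 ⊆ Z1) : e' = d' ∨ e' = -d' := by
  haveI : Fact (Nat.Prime 59) := ⟨prime_59⟩
  -- S: d′ = k e′
  have hrJ : apFinset r d' 4 ⊆ apFinset v e' 14 := hr.trans (by rw [← hJ]; exact Finset.subset_union_left)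
  obtain ⟨k, hk, hk0, hkb⟩ := exists_int_mul_of_apFinset_subset hd' he' (by norm_num) (by norm_num) hrJ
  -- T: e′ = j d′
  obtain ⟨x, hx, hxe⟩ := exists_adjacent_of_card_le_four he' hJ hZ2
  have hxI : apFinset x e' 2 ⊆ apFinset z₀ d' 20 := by
    intro y hy
    obtain ⟨i, hi, rfl⟩ := mem_apFinset.1 hy
    interval_cases i
    · simpa using hI hx
    · simpa using hI hxe
  obtain ⟨j, hj, hj0, hjb⟩ := exists_int_mul_of_apFinset_subset he' hd' (by norm_num) (by norm_num) hxI
  -- U: k j ≡ 1 (mod 59)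
  have hprod : (((k * j - 1 : ℤ)) : ZMod 59) * d' = 0 := by
    push_cast
    have : d' = (k : ZMod 59) * ((j : ZMod 59) * d') := by rw [← hj, ← hk]
    linear_combination (-1 : ZMod 59) * this
  have hdvd : ((59 : ℕ) : ℤ) ∣ (k * j - 1) :=
    (ZMod.intCast_zmod_eq_zero_iff_dvd _ 59).1 ((mul_eq_zero.1 hprod).resolve_right hd')
  have hk4 : k.natAbs ≤ 4 := by omega
  have hj19 : j.natAbs ≤ 19 := by omega
  have hcases : j = 1 ∨ j = -1 ∨ j = 15 ∨ j = -15 := by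
    have hk' : -4 ≤ k ∧ k ≤ 4 := by omega
    have hj' : -19 ≤ j ∧ j ≤ 19 := by omega
    obtain ⟨t, ht⟩ := hdvd
    push_cast at ht
    rcases hk' with ⟨hk1, hk2⟩
    interval_cases k <;> omega
  -- V: exclude ±15 by counting, conclude
  obtain ⟨u, hu⟩ : ∃ u : ZMod 59, u = d'⁻¹ := ⟨_, rfl⟩
  have hu0 : u ≠ 0 := by rw [hu]; exact inv_ne_zero hd'
  have hud : u * d' = 1 := by rw [hu]; exact inv_mul_cancel₀ hd'
  obtain ⟨w, hw⟩ : ∃ w : ZMod 59, w = -(u * z₀) := ⟨_, rfl⟩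
  have hφinj : Function.Injective (fun x : ZMod 59 => u * x + w) := affine_injective hu0 w
  have hφI : (apFinset z₀ d' 20).image (fun x => u * x + w) = apFinset 0 1 20 := by
    rw [image_affine_apFinset, hud, hw, add_neg_cancel]
  have hcount : ∀ c : ZMod 59, (c = 15 ∨ c = -15) → e' = c * d' → False := by
    intro c hc hec
    have hφJ : (apFinset v e' 14).image (fun x => u * x + w) = apFinset (u * v + w) c 14 := by
      rw [image_affine_apFinset, hec]
      congr 1
      calc u * (c * d') = c * (u * d') := by ring
        _ = c := by rw [hud, mul_one]
    have hsub : Z1.image (fun x => u * x + w) ⊆ apFinset (u * v + w) c 14 ∩ apFinset 0 1 20 := by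
      rw [← hφJ, ← hφI]
      exact Finset.subset_inter (Finset.image_subset_image (by rw [← hJ]; exact Finset.subset_union_left))
        (Finset.image_subset_image hI)
    have hcard := Finset.card_le_card hsub
    rw [Finset.card_image_of_injective _ hφinj, hZ1] at hcard
    rcases hc with rfl | rfl
    · have := ap14_step15_meets_run20 (u * v + w); omega
    · have := ap14_step_neg15_meets_run20 (u * v + w); omega
  rcases hcases with rfl | rfl | rfl | rfl
  · left; simpa using hj
  · right; simpa using hj
  · exact (hcount 15 (Or.inl rfl) (by simpa using hj)).elim
  · exact (hcount (-15) (Or.inr rfl) (by simpa using hj)).elim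

end Step3

/-! ## Step 5 and assembly: the Vosper clash -/

section Clash

/-- **VOSPER CLASH (kernel): the beating pattern `{(2,2,5),(2,5,2),(5,2,2)}` (`Σ abc = 60 > 59`) is realised by NO STPP family in `ℤ₅₉`.**
Both blocks `(2,5,2)` and `(5,2,2)` are N18-tight; Vosper (`vosper_structure_of_n18_tight`) makes `A₃`, `B₂` five-term progressions and `Y₁⊔Y₂`, `Z₁⊔Z₃`
twenty-term progressions of steps `e`, `d′` with `d′ = ±e` (`vosper225_step1`); `Z₃ = C₃ − A₃` is two 5-runs of the 20-run `Z₁ ⊔ Z₃`, so `Z₁` holds a 4-run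
(`exists_run4`); the 14-progression `Z₁ ⊔ Z₂` of step `e′ = ±(B₃'s difference)` then has `e′ = ±d′` (`step_pm_of_run4`); so `B₃ = {b, b ± d′}` while
`A₃ ∋ α′, α′ + d′` — and the word `(s′ − s) + (t′ − t) + (γ − γ) = 0` of Def. 5.1 at `(2,2,2)` forces `t = t′`, i.e. `e′ = 0`: contradiction.
HOME `pub-omega-stpp-1-g28/VOSPER-CLASH-225.md` (paper, where Steps 3–4 run on the `Y`-side; the `Z`-side used here avoids the grid case analysis); engine
cross-check sgen UNSAT 734 320 817 nodes. [cite: CohnKleinbergSzegedyUmans2005, Def. 5.1] [cite: Nathanson1996, Thm 2.7] -/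
theorem no_isSTPP_zmod59_225_252_522 (A B C : Fin 3 → Finset (ZMod 59)) (hS : IsSTPP A B C)
    (hA : ∀ i, #(A i) = ![2, 2, 5] i) (hB : ∀ i, #(B i) = ![2, 5, 2] i) (hC : ∀ i, #(C i) = ![5, 2, 2] i) : False := by
  haveI : Fact (Nat.Prime 59) := ⟨prime_59⟩
  have hAne : ∀ i, (A i).Nonempty := fun i => card_pos.1 (by rw [hA]; fin_cases i <;> simp)
  have hBne : ∀ i, (B i).Nonempty := fun i => card_pos.1 (by rw [hB]; fin_cases i <;> simp)
  have hCne : ∀ i, (C i).Nonempty := fun i => card_pos.1 (by rw [hC]; fin_cases i <;> simp)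
  obtain ⟨⟨⟨e, he, hA3, hIY⟩, ⟨e', he', hB3, hJZ⟩⟩, ⟨-, ⟨d', hd', hB2, hIZ⟩⟩⟩ := vosper225_structure A B C hS hA hB hC
  have hpm : d' = e ∨ d' = -e := vosper225_step1 A B C hS hA hB hC he hd' hA3 hIY hB2 hIZ
  -- the difference sets Z₁, Z₂, Z₃
  have e2 : (univ : Finset (Fin 3)).erase 2 = {0, 1} := by decide
  have e1 : (univ : Finset (Fin 3)).erase 1 = {0, 2} := by decide
  have hZ13 : D A C 0 ∪ D A C 2 = DU A C (univ.erase 1) := by rw [e1, DU_pair A C 0 2]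
  have hZ12 : D A C 0 ∪ D A C 1 = DU A C (univ.erase 2) := by rw [e2, DU_pair A C 0 1]
  have hZ1card : #(D A C 0) = 10 := by rw [card_D_AC hS hBne, hA, hC]; simp
  have hZ2card : #(D A C 1) = 4 := by rw [card_D_AC hS hBne, hA, hC]; simp
  have hZ3card : #(D A C 2) = 10 := by rw [card_D_AC hS hBne, hA, hC]; simp
  have hIZcard : #(DU A C (univ.erase 1)) = 20 := by
    rw [card_DU_AC hS hBne, e1, Finset.sum_pair (by decide)]; simp [hA, hC]
  have hJZcard : #(DU A C (univ.erase 2)) = 14 := by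
    rw [card_DU_AC hS hBne, e2, Finset.sum_pair (by decide)]; simp [hA, hC]
  obtain ⟨z₀, hz⟩ := hIZ
  obtain ⟨v, hv⟩ := hJZ
  rw [hIZcard] at hz; rw [hJZcard] at hv
  -- A₃ as a 5-progression of step d′ (reversing it if e = −d′)
  have hA2 : #(A 2) = 5 := by rw [hA]; simp
  have hAd : ∃ α' : ZMod 59, A 2 = apFinset α' d' 5 := by
    obtain ⟨α, hα⟩ := hA3
    rw [hA2] at hα
    rcases hpm with h | h
    · exact ⟨α, by rw [h]; exact hα⟩
    · refine ⟨α - 4 • d', ?_⟩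
      have : e = -d' := by rw [h, neg_neg]
      rw [hα, this]; exact apFinset_neg_step α d' 4
  obtain ⟨α', hα'⟩ := hAd
  -- C₃ = {γ, γ̄}
  have hC2 : #(C 2) = 2 := by rw [hC]; simp
  obtain ⟨γ, γ', hγγ, hCeq⟩ := Finset.card_eq_two.1 hC2
  have hγ : γ ∈ C 2 := by rw [hCeq]; simp
  have hγ' : γ' ∈ C 2 := by rw [hCeq]; simp
  -- the two 5-runs of Z₃
  have hU1 : apFinset (γ - α' - 4 • d') d' 5 ⊆ D A C 2 := by
    rw [← image_sub_apFinset, ← hα']; exact image_sub_subset_D hγ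
  have hU2 : apFinset (γ' - α' - 4 • d') d' 5 ⊆ D A C 2 := by
    rw [← image_sub_apFinset, ← hα']; exact image_sub_subset_D hγ'
  have hU12 : Disjoint (apFinset (γ - α' - 4 • d') d' 5) (apFinset (γ' - α' - 4 • d') d' 5) := by
    rw [← image_sub_apFinset, ← image_sub_apFinset, ← hα', Finset.disjoint_left]
    intro x hx hx'
    obtain ⟨a, ha, rfl⟩ := Finset.mem_image.1 hx
    obtain ⟨a', ha', heq⟩ := Finset.mem_image.1 hx'
    obtain ⟨b, hb⟩ := hBne 2
    -- word at (2,2,2): (a − a′) + (b − b) + (γ′ − γ) = 0 … forces γ = γ′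
    have hrel : (a - a') + (b - b) + (γ' - γ) = 0 := by
      have : γ' - a' = γ - a := heq
      linear_combination this
    obtain ⟨-, -, -, -, h5⟩ := hS 2 2 2 a' ha' a ha b hb b hb γ hγ γ' hγ' hrel
    exact hγγ h5
  -- Step 2: a 4-run in Z₁
  obtain ⟨r, hr⟩ := exists_run4 hd' (by rw [hZ13, hz]) (disjoint_D_AC hS hBne (by decide)) hZ3card hU1 hU2 hU12
  -- Step 3: e′ = ±d′
  have hZ1I : D A C 0 ⊆ apFinset z₀ d' 20 := by rw [← hz, ← hZ13]; exact Finset.subset_union_left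
  have hpm' : e' = d' ∨ e' = -d' :=
    step_pm_of_run4 hd' he' hZ1I (by rw [hZ12, hv]) (by rw [hZ2card]) hZ1card hr
  -- Step 5: B₃ = {b, b + e′}, A₃ ∋ α′, α′ + d′ — the TPP of block 3 fails
  have hB2c : #(B 2) = 2 := by rw [hB]; simp
  obtain ⟨b, hb⟩ := hB3
  rw [hB2c] at hb
  have hbmem : b ∈ B 2 := by rw [hb]; exact mem_apFinset.2 ⟨0, by norm_num, by simp⟩
  have hbe : b + e' ∈ B 2 := by rw [hb]; exact mem_apFinset.2 ⟨1, by norm_num, by simp⟩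
  have hαmem : α' ∈ A 2 := by rw [hα']; exact mem_apFinset.2 ⟨0, by norm_num, by simp⟩
  have hαd : α' + d' ∈ A 2 := by rw [hα']; exact mem_apFinset.2 ⟨1, by norm_num, by simp⟩
  rcases hpm' with h | h
  · -- e′ = d′: s′ = α′, s = α′ + d′, t = b, t′ = b + e′
    have hrel : (α' - (α' + d')) + ((b + e') - b) + (γ - γ) = 0 := by rw [h]; ring
    obtain ⟨-, -, -, h4, -⟩ := hS 2 2 2 (α' + d') hαd α' hαmem b hbmem (b + e') hbe γ hγ γ hγ hrel
    exact he' (by linear_combination h4.symm)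
  · -- e′ = −d′: s′ = α′ + d′, s = α′
    have hrel : ((α' + d') - α') + ((b + e') - b) + (γ - γ) = 0 := by rw [h]; ring
    obtain ⟨-, -, -, h4, -⟩ := hS 2 2 2 α' hαmem (α' + d') hαd b hbmem (b + e') hbe γ hγ γ hγ hrel
    exact he' (by linear_combination h4.symm)

end Clash

end Summit.MatrixMultiplication.OmegaCensus.CubeNB
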